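import Mathlib.MeasureTheory.Measure.Lebesgue.EqHaar
import Literature.Probability.RandomPlanarGeometry.BrownianLoopMeasureConformal
import HarnessLib

/-!
# Similarity invariance of the Brownian loop measure and of `Λ(K₁, K₂; D)`

The special case of the conformal invariance of the Brownian loop measure (Lawler–Werner, *The
Brownian loop soup*, PTRF **128** (2004) (**[LW04]**), §4.1, Prop. 6) in which the conformal
map is a similarity `s(z) = a z + b` of the plane with `a > 0` real — translations and dilations.
Here no Brownian input is needed: in the product description of the rooted loop measure,
"`area × dt/(2π t²) × μ^#`" (Lawler, *Conformally Invariant Processes in the Plane* (2005),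
Remark 5.28; the tree's `BrownianLoop.base`), the similarity acts on the triple `(z, t, η)` by
`(z, t, η) ↦ (a z + b, a² t, η)` (Brownian scaling of the bridge is absorbed by the duration:
`s(z + √t η) = (a z + b) + √(a² t) η`), the area picks up the Jacobian `a²` and `dt/(2π t²)`
the Jacobian `a⁻²`, so the base measure is preserved.

* `BrownianLoop.map_timeMeasure_mul` — `(dt/(2πt²) on (0,∞)).map (c ·) = c • (dt/(2πt²))`;
* `BrownianLoop.map_base_similarity` — the base measure is invariant under
  `(z, t, ω) ↦ (a z + b, a² t, ω)`;
* `map_imageOn_brownianLoopMeasure_univ_similarity` — **`s_* μ^loop = μ^loop`**, and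
  `map_imageOn_brownianLoopMeasure_similarity` — **`s_* μ^loop_D = μ^loop_{s(D)}`** for open `D`
  ([LW04] Prop. 6 for similarities);
* `loopMass_similarity` — **`Λ(s(K₁), s(K₂); s(D)) = Λ(K₁, K₂; D)`** for open `D`, `K₁, K₂ ⊆ D`
  (Lawler, J. Stat. Phys. **134** (2009), §2.2, for similarities), via the transport theorem
  `loopMass_image_eq_of_map_eq` of `BrownianLoopMeasureConformal`.

The similarity is a variable `s : ℂ → ℂ` with the hypothesis `∀ z, s z = a * z + b` (so that the
statements apply to any syntactic form of the map). Rotations `z ↦ e^{iθ} z` would in addition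
need the rotation invariance of the law of the planar Brownian pair and are not treated.

## References

* G. F. Lawler, W. Werner, *The Brownian loop soup*, PTRF 128 (2004), §4.1, Prop. 6.
* G. F. Lawler, *Conformally Invariant Processes in the Plane*, AMS (2005), §5.6, Remark 5.28.
* G. F. Lawler, *Partition functions, loop measure, and versions of SLE*, J. Stat. Phys. 134
  (2009), §2.2.
-/

noncomputable section

open Set Filter MeasureTheory Metric
open scoped unitInterval NNReal ENNReal Real Topology

namespace Literature.Probability.RandomPlanarGeometry

open Literature.Probability.Process (WienerPair wienerPair)
open BrownianLoop UnbasedLoop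

namespace BrownianLoop

/-! ### The Jacobians: area and `dt/(2π t²)` under a dilation -/

/-- `c² · (1/(2π (c t)²)) = 1/(2π t²)` (also at `t = 0`, where both vanish). [folklore] -/
theorem ofReal_sq_mul_timeDensity_mul {c : ℝ} (hc : 0 < c) (t : ℝ) :
    ENNReal.ofReal (c ^ 2) * timeDensity (c * t) = timeDensity t := by
  rw [timeDensity, timeDensity, ← ENNReal.ofReal_mul (sq_nonneg c)]
  congr 1
  rcases eq_or_ne t 0 with rfl | ht
  · simp
  · field_simp

/-- **`dt/(2π t²)` on `(0, ∞)` scales by `c` under `t ↦ c t`** (`c > 0`): the push-forward of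
`timeMeasure` under the dilation by `c` is `c • timeMeasure` (change of variables `u = c t`,
`dt/t² = c · du/u²`). [folklore] -/
theorem map_timeMeasure_mul {c : ℝ} (hc : 0 < c) :
    timeMeasure.map (fun t ↦ c * t) = ENNReal.ofReal c • timeMeasure := by
  have hm : Measurable fun t : ℝ ↦ c * t := measurable_const_mul c
  ext s hs
  rw [Measure.map_apply hm hs, Measure.smul_apply, timeMeasure, withDensity_apply _ (hm hs),
    withDensity_apply _ hs, Measure.restrict_restrict (hm hs), Measure.restrict_restrict hs,
    ← lintegral_indicator ((hm hs).inter measurableSet_Ioi),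
    ← lintegral_indicator (hs.inter measurableSet_Ioi), smul_eq_mul]
  -- the integrand on the left is `G (c t)` with `G = 𝟙_{s ∩ (0,∞)} · c² · timeDensity`
  set G : ℝ → ℝ≥0∞ := (s ∩ Ioi 0).indicator fun u ↦ ENNReal.ofReal (c ^ 2) * timeDensity u
    with hG
  have hpre : (fun t ↦ c * t) ⁻¹' s ∩ Ioi 0 = (fun t ↦ c * t) ⁻¹' (s ∩ Ioi 0) := by
    ext t
    simp only [mem_inter_iff, mem_preimage, mem_Ioi]
    exact and_congr_right fun _ ↦ by constructor <;> intro h <;> nlinarith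
  have hint : ((fun t ↦ c * t) ⁻¹' s ∩ Ioi 0).indicator timeDensity = fun t ↦ G (c * t) := by
    funext t
    rw [hpre, hG]
    by_cases ht : c * t ∈ s ∩ Ioi 0
    · rw [indicator_of_mem (show t ∈ (fun t ↦ c * t) ⁻¹' (s ∩ Ioi 0) from ht),
        indicator_of_mem ht, ofReal_sq_mul_timeDensity_mul hc t]
    · rw [indicator_of_notMem (show t ∉ (fun t ↦ c * t) ⁻¹' (s ∩ Ioi 0) from ht),
        indicator_of_notMem ht]
  -- change of variables `u = c t`
  have hcv : ∫⁻ t, G (c * t) = ENNReal.ofReal |c⁻¹| * ∫⁻ u, G u := by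
    have h := lintegral_map_equiv (μ := volume) G (Homeomorph.mulLeft₀ c hc.ne').toMeasurableEquiv
    rw [Homeomorph.toMeasurableEquiv_coe, Homeomorph.coe_mulLeft₀, Real.map_volume_mul_left hc.ne',
      lintegral_smul_measure, smul_eq_mul] at h
    exact h.symm
  have hGi : ∫⁻ u, G u = ENNReal.ofReal (c ^ 2) * ∫⁻ u, (s ∩ Ioi 0).indicator timeDensity u := by
    rw [← lintegral_const_mul' _ _ ENNReal.ofReal_ne_top, hG]
    congr 1
    funext u
    simp only [indicator]
    split_ifs <;> simp
  rw [hint, hcv, hGi, ← mul_assoc, abs_of_pos (inv_pos.2 hc),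
    ← ENNReal.ofReal_mul (inv_pos.2 hc).le, show c⁻¹ * c ^ 2 = c by field_simp]

/-- **Area scales by `a⁻²` and is translation invariant**: the push-forward of Lebesgue measure on
`ℂ` under `z ↦ a z + b` (`a > 0` real) is `a⁻² •` Lebesgue measure. [folklore] -/
theorem map_volume_similarity {a : ℝ} (ha : 0 < a) (b : ℂ) {s : ℂ → ℂ}
    (hs : ∀ z, s z = a * z + b) :
    (volume : Measure ℂ).map s = ENNReal.ofReal (a ^ 2)⁻¹ • volume := by
  have hs' : s = (fun z ↦ b + z) ∘ fun z : ℂ ↦ (a : ℝ) • z := by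
    funext z; rw [Function.comp_apply, hs, Complex.real_smul, add_comm]
  rw [hs', ← Measure.map_map (measurable_const_add b) (measurable_const_smul (a : ℝ)),
    Measure.map_addHaar_smul volume ha.ne', Complex.finrank_real_complex, Measure.map_smul,
    map_add_left_eq_self, abs_of_pos (inv_pos.2 (pow_pos ha 2))]

/-- **The base measure `area × dt/(2πt²) × ℙ` is invariant under the similarity acting on
triples**, `(z, t, ω) ↦ (a z + b, a² t, ω)`: the Jacobians `a⁻²` of the area and `a²` of
`dt/(2π t²)` cancel ([Lawler] Remark 5.28's product form; [LW04] §4.1). [folklore] -/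
theorem map_base_similarity {a : ℝ} (ha : 0 < a) (b : ℂ) {s : ℂ → ℂ}
    (hs : ∀ z, s z = a * z + b) :
    base.map (Prod.map s (Prod.map (fun t : ℝ ↦ a ^ 2 * t) id)) = base := by
  have hsm : Measurable s := by
    rw [show s = fun z ↦ (a : ℂ) * z + b from funext hs]; fun_prop
  have ha2 : 0 < a ^ 2 := pow_pos ha 2
  rw [base, ← Measure.map_prod_map _ _ hsm ((measurable_const_mul _).prodMap measurable_id),
    ← Measure.map_prod_map _ _ (measurable_const_mul _) measurable_id, Measure.map_id,
    map_volume_similarity ha b hs, map_timeMeasure_mul ha2, Measure.prod_smul_left,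
    Measure.prod_smul_left, Measure.prod_smul_right, smul_smul,
    ← ENNReal.ofReal_mul (inv_pos.2 ha2).le, inv_mul_cancel₀ ha2.ne', ENNReal.ofReal_one,
    one_smul]

/-! ### The similarity on rooted loops -/

/-- **`s ∘ γ_{z,t,ω} = γ_{s(z), a²t, ω}`**: the image of the rooted loop of `(z, t, ω)` under
`s(z) = a z + b` is the rooted loop of `(a z + b, a² t, ω)` (same bridge sample:
`a √t η = √(a² t) η`). [folklore] -/
theorem imageOn_rooted_similarity {a : ℝ} (ha : 0 < a) (b : ℂ) {s : ℂ → ℂ}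
    (hs : ∀ z, s z = a * z + b) (p : ℂ × ℝ × WienerPair) :
    (rooted p).imageOn s univ = rooted (Prod.map s (Prod.map (fun t : ℝ ↦ a ^ 2 * t) id) p) := by
  have hsc : Continuous s := by
    rw [show s = fun z ↦ (a : ℂ) * z + b from funext hs]; fun_prop
  obtain ⟨z, t, ω⟩ := p
  apply DFunLike.coe_injective
  funext u
  change (rooted (z, t, ω)).imageOn s univ u = rooted (s z, a ^ 2 * t, ω) u
  rw [Curve.imageOn_apply hsc.continuousOn (subset_univ _), rooted_apply, rooted_apply]
  dsimp only
  rw [hs, hs, Real.sqrt_mul (sq_nonneg a), Real.sqrt_sq ha.le]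
  push_cast
  ring

/-- The unrooted loop of the transformed triple is the image of the unrooted loop. [folklore] -/
theorem unrooted_similarity {a : ℝ} (ha : 0 < a) (b : ℂ) {s : ℂ → ℂ}
    (hs : ∀ z, s z = a * z + b) (p : ℂ × ℝ × WienerPair) :
    unrooted (Prod.map s (Prod.map (fun t : ℝ ↦ a ^ 2 * t) id) p) = imageOn s univ (unrooted p) := by
  rw [unrooted, unrooted, imageOn_unroot]
  exact congrArg Curve.unroot (Subtype.ext (imageOn_rooted_similarity ha b hs p).symm)

end BrownianLoop

/-! ### Similarity invariance of `μ^loop`, `μ^loop_D` and `Λ` -/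

variable {a : ℝ} {b : ℂ} {s : ℂ → ℂ}

/-- **`s_* μ^loop = μ^loop`** for the similarity `s(z) = a z + b`, `a > 0` ([LW04] Prop. 6 for
similarities of the plane): the loop measure of `ℂ` is invariant under translations and
dilations. [cite: LawlerWerner2004, §4.1 Prop. 6] -/
theorem map_imageOn_brownianLoopMeasure_univ_similarity (ha : 0 < a) (hs : ∀ z, s z = a * z + b) :
    (brownianLoopMeasure univ).map (imageOn s univ) = brownianLoopMeasure univ := by
  have hsm : Measurable s := by
    rw [show s = fun z ↦ (a : ℂ) * z + b from funext hs]; fun_prop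
  have hΦ : Measurable (Prod.map s (Prod.map (fun t : ℝ ↦ a ^ 2 * t) (id : WienerPair → _))) :=
    hsm.prodMap ((measurable_const_mul _).prodMap measurable_id)
  rw [brownianLoopMeasure_univ, Measure.map_map (measurable_imageOn isOpen_univ) measurable_unrooted,
    show imageOn s univ ∘ unrooted = unrooted ∘ Prod.map s (Prod.map (fun t : ℝ ↦ a ^ 2 * t) id)
      from funext fun p ↦ (unrooted_similarity ha b hs p).symm,
    ← Measure.map_map measurable_unrooted hΦ, map_base_similarity ha b hs]

/-- On loops in `D ⊆ D₂`, `imageOn f D` and `imageOn f D₂` agree (for `f` continuous on `D₂`).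
[folklore] -/
theorem UnbasedLoop.imageOn_eq_imageOn_of_subset {E : Type*} [MetricSpace E] {f : E → E}
    {D D₂ : Set E} (hD : D ⊆ D₂) (hf : ContinuousOn f D₂) {u : UnbasedLoop E} (hu : u.range ⊆ D) :
    imageOn f D u = imageOn f D₂ u := by
  obtain ⟨⟨γ, hγ⟩, rfl⟩ := exists_unroot_eq u
  rw [imageOn_unroot, imageOn_unroot]
  refine congrArg Curve.unroot (Subtype.ext ?_)
  apply DFunLike.coe_injective
  funext t
  change Curve.imageOn f D γ t = Curve.imageOn f D₂ γ t
  rw [Curve.imageOn_apply (hf.mono hD) hu, Curve.imageOn_apply hf (hu.trans hD)]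

/-- A similarity with `a > 0` is injective. [folklore] -/
theorem similarity_injective (ha : 0 < a) (hs : ∀ z, s z = a * z + b) : Function.Injective s := by
  intro x y h
  rw [hs, hs] at h
  have ha' : (a : ℂ) ≠ 0 := by exact_mod_cast ha.ne'
  exact mul_left_cancel₀ ha' (add_right_cancel h)

/-- **`s_* μ^loop_D = μ^loop_{s(D)}`** for open `D` and the similarity `s(z) = a z + b`, `a > 0`
([LW04] Prop. 6, "`f ∘ μ^loop_D = μ^loop_{D'}`", for similarities): restriction of the
invariance of `μ^loop` to the loops in `D`, which `[γ] ↦ [s ∘ γ]` maps onto the loops in `s(D)`.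
[cite: LawlerWerner2004, §4.1 Prop. 6] -/
theorem map_imageOn_brownianLoopMeasure_similarity (ha : 0 < a) (hs : ∀ z, s z = a * z + b)
    {D : Set ℂ} (hD : IsOpen D) (hD' : IsOpen (s '' D)) :
    (brownianLoopMeasure D).map (imageOn s D) = brownianLoopMeasure (s '' D) := by
  have hsc : Continuous s := by
    rw [show s = fun z ↦ (a : ℂ) * z + b from funext hs]; fun_prop
  have hmD := measurableSet_inside_of_isOpen hD
  have hmD' := measurableSet_inside_of_isOpen hD'
  have hF := measurable_imageOn (f := s) (isOpen_univ : IsOpen (univ : Set ℂ))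
  -- on the loops in `D`, `imageOn s D = imageOn s univ`
  have hae : imageOn s D =ᵐ[brownianLoopMeasure D] imageOn s univ := by
    rw [brownianLoopMeasure_eq_restrict]
    filter_upwards [ae_restrict_mem hmD] with u hu
    exact imageOn_eq_imageOn_of_subset (subset_univ D) hsc.continuousOn hu
  -- the loops in `D` are the preimage of the loops in `s(D)`
  have hpre : imageOn s univ ⁻¹' inside (s '' D) = inside D := by
    ext u
    rw [mem_preimage, mem_inside, mem_inside, range_imageOn hsc.continuousOn (subset_univ _),
      image_subset_image_iff (similarity_injective ha hs)]
  rw [Measure.map_congr hae, brownianLoopMeasure_eq_restrict D, brownianLoopMeasure_eq_restrict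
    (s '' D), ← hpre, ← Measure.restrict_map hF hmD',
    map_imageOn_brownianLoopMeasure_univ_similarity ha hs]

/-- A similarity with `a > 0` maps open sets to open sets. [folklore] -/
theorem isOpen_image_similarity (ha : 0 < a) (hs : ∀ z, s z = a * z + b) {D : Set ℂ}
    (hD : IsOpen D) : IsOpen (s '' D) := by
  have ha' : (a : ℂ) ≠ 0 := by exact_mod_cast ha.ne'
  have he : s = (Homeomorph.mulLeft₀ (a : ℂ) ha').trans (Homeomorph.addRight b) := by
    funext z; rw [hs]; rfl
  rw [he]
  exact (Homeomorph.isOpenMap _) D hD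

/-- **Similarity invariance of `Λ`**: for open `D`, `K₁, K₂ ⊆ D` and `s(z) = a z + b` with
`a > 0`, `Λ(s(K₁), s(K₂); s(D)) = Λ(K₁, K₂; D)` (Lawler, J. Stat. Phys. 134 (2009), §2.2:
"`Λ(f(K₁), f(K₂); f(D)) = Λ(K₁, K₂; D)`", here for similarities; from
`map_imageOn_brownianLoopMeasure_similarity` and the transport theorem
`loopMass_image_eq_of_map_eq`). [cite: Lawler2009, §2.2] -/
theorem loopMass_similarity (ha : 0 < a) (hs : ∀ z, s z = a * z + b) {D K₁ K₂ : Set ℂ}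
    (hD : IsOpen D) (h₁ : K₁ ⊆ D) (h₂ : K₂ ⊆ D) :
    loopMass (s '' D) (s '' K₁) (s '' K₂) = loopMass D K₁ K₂ := by
  have hsc : Continuous s := by
    rw [show s = fun z ↦ (a : ℂ) * z + b from funext hs]; fun_prop
  have ha' : (a : ℂ) ≠ 0 := by exact_mod_cast ha.ne'
  set g : ℂ → ℂ := fun w ↦ (a : ℂ)⁻¹ * (w - b) with hg
  have hgc : Continuous g := by rw [hg]; fun_prop
  have hgs : ∀ z, g (s z) = z := fun z ↦ by rw [hg, hs]; field_simp; ring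
  have hsg : ∀ w, s (g w) = w := fun w ↦ by rw [hs, hg]; field_simp; ring
  have hD' := isOpen_image_similarity ha hs hD
  refine loopMass_image_eq_of_map_eq hD hD' hsc.continuousOn hgc.continuousOn (mapsTo_image s D)
    ?_ (fun z _ ↦ hgs z) (fun w _ ↦ hsg w) (map_imageOn_brownianLoopMeasure_similarity ha hs hD hD')
    h₁ h₂
  rintro _ ⟨z, hz, rfl⟩
  rwa [hgs]

/-- `Λ` is invariant under the maps `z ↦ a z + b`, `a > 0` (explicit form of
`loopMass_similarity`). [cite: Lawler2009, §2.2] -/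
theorem loopMass_image_affine (ha : 0 < a) (b : ℂ) {D K₁ K₂ : Set ℂ} (hD : IsOpen D)
    (h₁ : K₁ ⊆ D) (h₂ : K₂ ⊆ D) :
    loopMass ((fun z ↦ (a : ℂ) * z + b) '' D) ((fun z ↦ (a : ℂ) * z + b) '' K₁)
      ((fun z ↦ (a : ℂ) * z + b) '' K₂) = loopMass D K₁ K₂ :=
  loopMass_similarity ha (fun _ ↦ rfl) hD h₁ h₂

end Literature.Probability.RandomPlanarGeometry

end
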